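import Summits.AtomisticToContinuum.BoseEinsteinCondensation.Theses.BECConjugateDomination
import Literature.MathematicalPhysics.QuantumManyBody.LangevinGenerator
import Summits.AtomisticToContinuum.BoseEinsteinCondensation.Theorems.InfraredMinimumUncertainty.Negative.FreeMinimisersConstant

/-!
# Stub `stub_densityFisherGaussianity` (FG), line `fisher-gaussian-density-mode` — free-gas calibration

Crux `BECConjugateDomination.InfraredMinimumUncertainty` (stmt-AtomisticToContinuum-11784). The registered
stub FG asks, for the positive torus minimiser `Ψ` of the `N = n+1`-body periodic energy and every mode
`m ≠ 0` (`k = (2π/L)·m`, `e_m = cellWave L m`, `Z_m = ∑ⱼ e_m(xⱼ)`, `W_m = ∑ⱼ e_m(xⱼ)(‖k‖²Ψ − 2i∂_{xⱼ·k}Ψ)`,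
`J_m(φ) = −(4/(N‖k‖²)) Re∫ φ̄(Z)WΨ̄ − ∫|φ(Z)|²|Ψ|²`), that `J_m(φ)·∫|Z_m|²|Ψ|² ≤ C` for every continuous
`φ : ℂ → ℂ`, uniformly (a Fisher-information local CLT for the density mode of the interacting ground
state down to the lowest mode: OPEN, not closed here). This file records the CLOSED calibration at the
degenerate member `v ≡ 0` of the potential class:

* (a) a minimiser of the FREE periodic energy is a constant — this is the landed
  `Theorems.InfraredMinimumUncertainty.Negative.exists_eq_const_of_free_minimiser` (importable form of the
  cdisprove seat's §E), used here; corollaries `fderiv_eq_zero_of_free_minimiser` (`dΨ ≡ 0`) and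
  `norm_sq_mul_volume_of_const` (`|c|²L^{3N} = 1`).
* (b) `integral_cellN_cellWave_mul_conj`, `integral_cellN_norm_sq_densityMode` — the phases `e_m(x_j)` in
  different particles are orthonormal on `cell^N`: `∫_{cell^N}|Z_m|² = N·L^{3N}` (`m ≠ 0`), so
  `∫|Z_m|²|Ψ|² = N` for a normalised constant state (`integral_norm_sq_densityMode_of_const`; `S_m = 1`).
* (c) `fisherGaussianity_free_at` — **FG at `v ≡ 0` with the sharp constant `4`** (every `L > 0`, `N`,
  `m ≠ 0`, continuous `φ`): `W = ‖k‖²ΨZ`, pointwise AM–GM gives `J(φ) ≤ (4/N²)∫|Z|²|Ψ|² = 4/N`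
  (attained at `φ = −(2/N)z`, Cramér–Rao); `fisherGaussianity_free` — the same in the stub's frame
  (`C = 4`, `ρ₀ = 1`, all `n`).

Complex Fubini on `cell^N` is the landed `Theorems.GaussianDominationCan.Negative.integral_cellN_prod`;
`pointwise_amgm` is the line skeleton's. All `[folklore]`.
-/


noncomputable section

open Literature.MathematicalPhysics.QuantumManyBody.BoseGas
open MeasureTheory Filter
open scoped ENNReal NNReal ComplexConjugate BigOperators

namespace Summit.AtomisticToContinuum.BoseEinsteinCondensation.Theorems.BECConjugateDomination

open Summit.AtomisticToContinuum.BoseEinsteinCondensation.Theorems.StaticResponseBound.Negative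
  (integral_norm_sq_eq_one)
open Summit.AtomisticToContinuum.BoseEinsteinCondensation.Theorems.CorrectorClosure.Negative
  (sideLength_succ_pos)
open Summit.AtomisticToContinuum.BoseEinsteinCondensation.Theorems.InfraredMinimumUncertainty.Negative
  (exists_eq_const_of_free_minimiser)
open Summit.AtomisticToContinuum.BoseEinsteinCondensation.Theorems.GaussianDominationCan.Negative
  (integral_cellN_prod)

/-! ## Calibration lemmas (closed) -/

/-! ### (a) The free minimiser is a constant: corollaries of `exists_eq_const_of_free_minimiser` -/

section FreeMinimisers

variable {n N : ℕ} {L : ℝ}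

/-- A minimiser of the FREE periodic energy has identically vanishing derivative (it is a constant,
`exists_eq_const_of_free_minimiser`). [folklore] -/
theorem fderiv_eq_zero_of_free_minimiser (hL : 0 < L) (Ψ : PeriodicTrialState (n + 1) L)
    (hE : periodicEnergy 0 Ψ = periodicGroundStateEnergy 0 (n + 1) L) (X : Config (n + 1)) :
    fderiv ℝ Ψ.ψ X = 0 := by
  obtain ⟨c, hc⟩ := exists_eq_const_of_free_minimiser hL Ψ hE
  rw [show Ψ.ψ = fun _ => c from funext hc]
  exact fderiv_const_apply c

/-- `|cell^N| = L^{3N}` as a real number. [folklore] -/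
theorem volume_real_cellN (hL : 0 ≤ L) (N : ℕ) : volume.real (cellN N L) = (L ^ 3) ^ N := by
  rw [Measure.real, volume_cellN, ENNReal.toReal_pow, ENNReal.toReal_pow, ENNReal.toReal_ofReal hL]

/-- Normalisation of a constant admissible state: `|c|² · L^{3N} = 1`. [folklore] -/
theorem norm_sq_mul_volume_of_const (hL : 0 < L) (Ψ : PeriodicTrialState N L) {c : ℂ}
    (hc : ∀ X, Ψ.ψ X = c) : ‖c‖ ^ 2 * (L ^ 3) ^ N = 1 := by
  have h := integral_norm_sq_eq_one Ψ
  simp_rw [hc] at h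
  rw [setIntegral_const, volume_real_cellN hL.le, smul_eq_mul] at h
  linarith [h]

end FreeMinimisers

/-! ### (b) Orthogonality of one-body plane waves in different particles: `∫_{cell^N}|Z_m|² = N L^{3N}` -/

section DensityMode

variable {N : ℕ} {L : ℝ}

/-- **Orthogonality of plane waves sitting in different particles**:
`∫_{cell^N} e_m(x_j) conj(e_m(x_l)) dX = δ_{jl} · L^{3N}` for `m ≠ 0` (`|e_m| = 1` on the diagonal;
off the diagonal the integral factorises and `∫_cell e_m = 0`). [folklore] -/
theorem integral_cellN_cellWave_mul_conj (hL : 0 < L) {m : Fin 3 → ℤ} (hm : m ≠ 0) (j l : Fin N) :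
    ∫ X in cellN N L, cellWave L m (X j) * starRingEnd ℂ (cellWave L m (X l)) =
      if j = l then ((((L ^ 3) ^ N : ℝ)) : ℂ) else 0 := by
  classical
  split_ifs with hjl
  · subst hjl
    have h1 : ∀ X : Config N, cellWave L m (X j) * starRingEnd ℂ (cellWave L m (X j)) = 1 := by
      intro X
      rw [Complex.mul_conj, Complex.normSq_eq_norm_sq, norm_cellWave]
      simp
    simp_rw [h1]
    rw [setIntegral_const, volume_real_cellN hL.le]
    simp
  · set f : Fin N → Space → ℂ := fun i x =>
      if i = j then cellWave L m x else if i = l then starRingEnd ℂ (cellWave L m x) else 1 with hf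
    have hprod : ∀ X : Config N,
        ∏ i, f i (X i) = cellWave L m (X j) * starRingEnd ℂ (cellWave L m (X l)) := by
      intro X
      rw [Finset.prod_eq_mul j l hjl]
      · simp [hf, Ne.symm hjl]
      · intro c _ hc
        simp [hf, hc.1, hc.2]
      · simp
      · simp
    simp_rw [← hprod]
    rw [integral_cellN_prod]
    refine Finset.prod_eq_zero (Finset.mem_univ j) ?_
    simp only [hf, if_true]
    exact integral_cell_cellWave_eq_zero hL hm

/-- `∫_{cell^N} Z_m · conj(Z_m) = N · L^{3N}` for `m ≠ 0`. [folklore] -/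
theorem integral_cellN_densityMode_mul_conj (hL : 0 < L) {m : Fin 3 → ℤ} (hm : m ≠ 0) :
    ∫ X in cellN N L, (∑ j : Fin N, cellWave L m (X j)) * starRingEnd ℂ (∑ j : Fin N, cellWave L m (X j)) =
      (((N * (L ^ 3) ^ N : ℝ)) : ℂ) := by
  classical
  have hexp : ∀ X : Config N,
      (∑ j : Fin N, cellWave L m (X j)) * starRingEnd ℂ (∑ j : Fin N, cellWave L m (X j)) =
        ∑ j : Fin N, ∑ l : Fin N, cellWave L m (X j) * starRingEnd ℂ (cellWave L m (X l)) := by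
    intro X
    rw [map_sum, Finset.sum_mul_sum]
  simp_rw [hexp]
  have hint : ∀ j l : Fin N, Integrable
      (fun X : Config N => cellWave L m (X j) * starRingEnd ℂ (cellWave L m (X l)))
      (volume.restrict (cellN N L)) := fun j l =>
    integrableOn_cellN (((contDiff_cellWave L m).continuous.comp (continuous_apply j)).mul
      (Complex.continuous_conj.comp ((contDiff_cellWave L m).continuous.comp (continuous_apply l)))) L
  rw [integral_finsetSum _ fun j _ => integrable_finsetSum _ fun l _ => hint j l]
  have hinner : ∀ j : Fin N, ∫ X in cellN N L, ∑ l : Fin N,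
      cellWave L m (X j) * starRingEnd ℂ (cellWave L m (X l)) = (((L ^ 3) ^ N : ℝ) : ℂ) := by
    intro j
    rw [integral_finsetSum _ fun l _ => hint j l]
    simp_rw [integral_cellN_cellWave_mul_conj hL hm]
    rw [Finset.sum_ite_eq]
    simp
  simp_rw [hinner]
  rw [Finset.sum_const, Finset.card_univ, Fintype.card_fin, nsmul_eq_mul]
  push_cast
  ring

/-- **`∫_{cell^N} |Z_m|² dX = N · L^{3N}`** for `m ≠ 0`: under the uniform law on the torus the `N`
phases `e_m(x_j)` are orthonormal. [folklore] -/
theorem integral_cellN_norm_sq_densityMode (hL : 0 < L) {m : Fin 3 → ℤ} (hm : m ≠ 0) :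
    ∫ X in cellN N L, ‖∑ j : Fin N, cellWave L m (X j)‖ ^ 2 = N * (L ^ 3) ^ N := by
  have h := integral_cellN_densityMode_mul_conj (N := N) hL hm
  have hpt : ∀ X : Config N,
      (∑ j : Fin N, cellWave L m (X j)) * starRingEnd ℂ (∑ j : Fin N, cellWave L m (X j)) =
        ((‖∑ j : Fin N, cellWave L m (X j)‖ ^ 2 : ℝ) : ℂ) := by
    intro X
    rw [Complex.mul_conj, Complex.normSq_eq_norm_sq, Complex.ofReal_pow]
  simp_rw [hpt] at h
  rw [integral_complex_ofReal] at h
  exact_mod_cast h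

/-- **The uncentred structure factor of a constant state is `1` at every mode `m ≠ 0`**:
`∫_{cell^N} |Z_m|² |Ψ|² = N` for a normalised constant `Ψ`. [folklore] -/
theorem integral_norm_sq_densityMode_of_const (hL : 0 < L) (Ψ : PeriodicTrialState N L) {c : ℂ}
    (hc : ∀ X, Ψ.ψ X = c) {m : Fin 3 → ℤ} (hm : m ≠ 0) :
    ∫ X in cellN N L, ‖∑ j : Fin N, cellWave L m (X j)‖ ^ 2 * ‖Ψ.ψ X‖ ^ 2 = N := by
  simp_rw [hc]
  rw [integral_mul_const, integral_cellN_norm_sq_densityMode hL hm]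
  have h1 := norm_sq_mul_volume_of_const hL Ψ hc
  calc (N : ℝ) * (L ^ 3) ^ N * ‖c‖ ^ 2 = (N : ℝ) * (‖c‖ ^ 2 * (L ^ 3) ^ N) := by ring
    _ = (N : ℝ) := by rw [h1, mul_one]

end DensityMode

/-! ### (c) FG at `v ≡ 0` with the sharp constant `4` -/

section FreeFisherGaussianity

variable {N : ℕ} {L : ℝ}

/-- The pointwise AM–GM inequality behind `J ≤ E|σ|²`: `−2a Re(p̄ W s̄) − |p|²|s|² ≤ a²|W|²` for `a ≥ 0`
(`2(a|W|)(|p||s|) ≤ (a|W|)² + (|p||s|)²`). [folklore] -/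
theorem pointwise_amgm {a : ℝ} (ha : 0 ≤ a) (p W s : ℂ) :
    -(2 * a) * (starRingEnd ℂ p * W * starRingEnd ℂ s).re - ‖p‖ ^ 2 * ‖s‖ ^ 2 ≤ a ^ 2 * ‖W‖ ^ 2 := by
  -- copied from the line skeleton `fisher-gaussian-density-mode.lean` (`pointwise_amgm`)
  have hre : -((starRingEnd ℂ p * W * starRingEnd ℂ s).re) ≤ ‖p‖ * ‖W‖ * ‖s‖ := by
    have h1 := Complex.abs_re_le_norm (starRingEnd ℂ p * W * starRingEnd ℂ s)
    rw [norm_mul, norm_mul, Complex.norm_conj, Complex.norm_conj] at h1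
    have := neg_abs_le ((starRingEnd ℂ p * W * starRingEnd ℂ s).re)
    linarith
  have h2 : 2 * (a * ‖W‖) * (‖p‖ * ‖s‖) ≤ (a * ‖W‖) ^ 2 + (‖p‖ * ‖s‖) ^ 2 := two_mul_le_add_sq _ _
  have h3 : -(2 * a) * (starRingEnd ℂ p * W * starRingEnd ℂ s).re ≤ 2 * (a * ‖W‖) * (‖p‖ * ‖s‖) := by
    have := mul_le_mul_of_nonneg_left hre (by positivity : 0 ≤ 2 * a)
    nlinarith
  nlinarith [h2, h3]

/-- `m ≠ 0 ⇒ latticeVec 1 m ≠ 0`. [folklore] -/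
theorem latticeVec_one_ne_zero {m : Fin 3 → ℤ} (hm : m ≠ 0) : latticeVec 1 m ≠ 0 := by
  intro h
  apply hm
  funext k
  have := congrArg (fun v : Space => v k) h
  simpa [latticeVec] using this

/-- `‖k‖ > 0` for the wave vector `k = (2π/L)·m` of a mode `m ≠ 0`. [folklore] -/
theorem norm_waveVec_pos (hL : 0 < L) {m : Fin 3 → ℤ} (hm : m ≠ 0) :
    0 < ‖(2 * Real.pi / L) • latticeVec 1 m‖ := by
  rw [norm_smul]
  exact mul_pos (by rw [Real.norm_eq_abs, abs_of_pos (by positivity)]; positivity)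
    (norm_pos_iff.mpr (latticeVec_one_ne_zero hm))

/-- **FG at the free gas, sharp constant.** For every `L > 0`, every `N = n+1`, every minimiser `Ψ` of
the FREE periodic energy (`periodicEnergy 0 Ψ = E₀^per(0)`; then `Ψ` is constant), every mode `m ≠ 0`
and every continuous test field `φ`:  `J_m(φ) · (N·S_m) ≤ 4`.  Indeed `W = ‖k‖²ΨZ`, so pointwise AM–GM
gives `J_m(φ) ≤ (4/N²)∫|Z|²|Ψ|²`, and `∫|Z|²|Ψ|² = N`. The statement is the registered stub's inline
conclusion with `sideLength ρ (n+1)` generalised to any `L > 0`. [folklore] -/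
theorem fisherGaussianity_free_at {n : ℕ} (hL : 0 < L) (Ψ : PeriodicTrialState (n + 1) L)
    (hE : periodicEnergy 0 Ψ = periodicGroundStateEnergy 0 (n + 1) L) {m : Fin 3 → ℤ} (hm : m ≠ 0)
    (φ : ℂ → ℂ) (hφ : Continuous φ) :
    (-(4 / (((n : ℝ) + 1) * ‖((2 * Real.pi / L) • latticeVec 1 m)‖ ^ 2)) *
        (∫ X in cellN (n + 1) L, (starRingEnd ℂ (φ (∑ j : Fin (n + 1), cellWave L m (X j))) *
          (∑ j : Fin (n + 1), cellWave L m (X j) *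
            (((‖((2 * Real.pi / L) • latticeVec 1 m)‖ ^ 2 : ℝ) : ℂ) * Ψ.ψ X -
              2 * Complex.I * fderiv ℝ Ψ.ψ X (Pi.single j ((2 * Real.pi / L) • latticeVec 1 m)))) *
          starRingEnd ℂ (Ψ.ψ X)).re) -
      ∫ X in cellN (n + 1) L, ‖φ (∑ j : Fin (n + 1), cellWave L m (X j))‖ ^ 2 * ‖Ψ.ψ X‖ ^ 2) *
    (((n : ℝ) + 1) * (((n : ℝ) + 1)⁻¹ * ∫ X in cellN (n + 1) L,
      ‖∑ j : Fin (n + 1), cellWave L m (X j)‖ ^ 2 * ‖Ψ.ψ X‖ ^ 2)) ≤ 4 := by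
  obtain ⟨c, hc⟩ := exists_eq_const_of_free_minimiser hL Ψ hE
  have hfd : ∀ X, fderiv ℝ Ψ.ψ X = 0 := fderiv_eq_zero_of_free_minimiser hL Ψ hE
  set k : Space := (2 * Real.pi / L) • latticeVec 1 m with hk
  set κ : ℝ := ‖k‖ ^ 2 with hκ
  have hκpos : 0 < κ := by have := norm_waveVec_pos hL hm; positivity
  set Nr : ℝ := (n : ℝ) + 1 with hNr
  have hNr_pos : 0 < Nr := by positivity
  -- the three integrands
  set Z : Config (n + 1) → ℂ := fun X => ∑ j : Fin (n + 1), cellWave L m (X j) with hZ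
  set Wf : Config (n + 1) → ℂ := fun X => ∑ j : Fin (n + 1), cellWave L m (X j) *
    (((κ : ℝ) : ℂ) * Ψ.ψ X - 2 * Complex.I * fderiv ℝ Ψ.ψ X (Pi.single j k)) with hWf
  set f₁ : Config (n + 1) → ℝ := fun X =>
    (starRingEnd ℂ (φ (Z X)) * Wf X * starRingEnd ℂ (Ψ.ψ X)).re with hf₁
  set f₂ : Config (n + 1) → ℝ := fun X => ‖φ (Z X)‖ ^ 2 * ‖Ψ.ψ X‖ ^ 2 with hf₂
  set f₃ : Config (n + 1) → ℝ := fun X => ‖Z X‖ ^ 2 * ‖Ψ.ψ X‖ ^ 2 with hf₃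
  -- `W = κ Ψ Z` for the constant state (no derivative term)
  have hW : ∀ X, Wf X = ((κ : ℝ) : ℂ) * Ψ.ψ X * Z X := fun X => by
    simp only [hWf, hZ, hfd X, _root_.zero_apply, mul_zero, sub_zero, Finset.mul_sum]
    exact Finset.sum_congr rfl fun j _ => by ring
  -- integrability
  have hZc : Continuous Z :=
    continuous_finsetSum _ fun j _ => (contDiff_cellWave L m).continuous.comp (continuous_apply j)
  have hψc : Continuous Ψ.ψ := Ψ.contDiff.continuous
  have hWc : Continuous Wf := by
    rw [show Wf = fun X => ((κ : ℝ) : ℂ) * Ψ.ψ X * Z X from funext hW]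
    exact (continuous_const.mul hψc).mul hZc
  have hi₁ : IntegrableOn f₁ (cellN (n + 1) L) volume := integrableOn_cellN (Complex.continuous_re.comp
    (((Complex.continuous_conj.comp (hφ.comp hZc)).mul hWc).mul (Complex.continuous_conj.comp hψc))) L
  have hi₂ : IntegrableOn f₂ (cellN (n + 1) L) volume :=
    integrableOn_cellN (((hφ.comp hZc).norm.pow 2).mul (hψc.norm.pow 2)) L
  have hi₃ : IntegrableOn f₃ (cellN (n + 1) L) volume :=
    integrableOn_cellN ((hZc.norm.pow 2).mul (hψc.norm.pow 2)) L
  -- pointwise AM–GM with `a = 2/(N κ)`: `−2a f₁ − f₂ ≤ a²|W|² = (4/N²) f₃`, then integrate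
  set a : ℝ := 2 / (Nr * κ) with ha_def
  have hpt : ∀ X, -(2 * a) * f₁ X - f₂ X ≤ 4 / Nr ^ 2 * f₃ X := fun X => by
    have h := pointwise_amgm (by positivity : 0 ≤ a) (φ (Z X)) (Wf X) (Ψ.ψ X)
    have h' : a ^ 2 * ‖Wf X‖ ^ 2 = 4 / Nr ^ 2 * f₃ X := by
      rw [hW X, norm_mul, norm_mul, Complex.norm_real, Real.norm_of_nonneg hκpos.le, ha_def, hf₃]
      field_simp
      ring
    linarith
  have key : ∫ X in cellN (n + 1) L, (-(2 * a) * f₁ X - f₂ X) ≤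
      ∫ X in cellN (n + 1) L, 4 / Nr ^ 2 * f₃ X :=
    integral_mono ((hi₁.const_mul _).sub hi₂) (hi₃.const_mul _) hpt
  rw [integral_sub (hi₁.const_mul _) hi₂, integral_const_mul, integral_const_mul] at key
  -- `∫ f₃ = N S_m = N`
  have hE3 : ∫ X in cellN (n + 1) L, f₃ X = Nr := by
    rw [hNr]; exact_mod_cast integral_norm_sq_densityMode_of_const hL Ψ hc hm
  rw [hE3] at key
  show (-(4 / (Nr * κ)) * (∫ X in cellN (n + 1) L, f₁ X) - ∫ X in cellN (n + 1) L, f₂ X) *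
      (Nr * (Nr⁻¹ * ∫ X in cellN (n + 1) L, f₃ X)) ≤ 4
  rw [hE3, mul_inv_cancel_left₀ hNr_pos.ne', show 4 / (Nr * κ) = 2 * a by rw [ha_def]; ring]
  calc (-(2 * a) * (∫ X in cellN (n + 1) L, f₁ X) - ∫ X in cellN (n + 1) L, f₂ X) * Nr
      ≤ 4 / Nr ^ 2 * Nr * Nr := mul_le_mul_of_nonneg_right key hNr_pos.le
    _ = 4 := by field_simp

/-- **FG holds at `v ≡ 0` in the quantifier frame of the stub** (`C = 4`, `ρ₀ = 1`, every `n`, the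
hypotheses `E ≠ ⊤`, `Ψ = |Ψ|`, `Ψ ≠ 0` unused): the registered signature of
`stub_densityFisherGaussianity` with `v := 0` substituted, after its four potential hypotheses. [folklore] -/
theorem fisherGaussianity_free :
    ∃ C : ℝ, 0 ≤ C ∧ ∃ ρ₀ : ℝ, 0 < ρ₀ ∧ ∀ ρ : ℝ, 0 < ρ → ρ < ρ₀ → ∀ᶠ n : ℕ in Filter.atTop,
      ∀ Ψ : PeriodicTrialState (n + 1) (sideLength ρ (n + 1)),
        periodicEnergy 0 Ψ = periodicGroundStateEnergy 0 (n + 1) (sideLength ρ (n + 1)) →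
        periodicEnergy 0 Ψ ≠ ⊤ → (∀ X, Ψ.ψ X = (‖Ψ.ψ X‖ : ℂ)) → (∀ X, Ψ.ψ X ≠ 0) →
        ∀ m : Fin 3 → ℤ, m ≠ 0 →
          ∀ φ : ℂ → ℂ, Continuous φ →
            (-(4 / (((n : ℝ) + 1) * ‖((2 * Real.pi / sideLength ρ (n + 1)) • latticeVec 1 m)‖ ^ 2)) *
              (∫ X in cellN (n + 1) (sideLength ρ (n + 1)), (starRingEnd ℂ (φ (∑ j : Fin (n + 1), cellWave (sideLength ρ (n + 1)) m (X j))) *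
                (∑ j : Fin (n + 1), cellWave (sideLength ρ (n + 1)) m (X j) *
              (((‖((2 * Real.pi / sideLength ρ (n + 1)) • latticeVec 1 m)‖ ^ 2 : ℝ) : ℂ) * Ψ.ψ X -
                2 * Complex.I * fderiv ℝ Ψ.ψ X (Pi.single j ((2 * Real.pi / sideLength ρ (n + 1)) • latticeVec 1 m)))) * starRingEnd ℂ (Ψ.ψ X)).re) -
            ∫ X in cellN (n + 1) (sideLength ρ (n + 1)), ‖φ (∑ j : Fin (n + 1), cellWave (sideLength ρ (n + 1)) m (X j))‖ ^ 2 * ‖Ψ.ψ X‖ ^ 2) *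
            (((n : ℝ) + 1) * (((n : ℝ) + 1)⁻¹ * ∫ X in cellN (n + 1) (sideLength ρ (n + 1)),
              ‖∑ j : Fin (n + 1), cellWave (sideLength ρ (n + 1)) m (X j)‖ ^ 2 * ‖Ψ.ψ X‖ ^ 2)) ≤ C :=
  ⟨4, by norm_num, 1, one_pos, fun ρ hρ _ => Filter.Eventually.of_forall fun n Ψ hE _ _ _ m hm φ hφ =>
    fisherGaussianity_free_at (sideLength_succ_pos hρ n) Ψ hE hm φ hφ⟩

end FreeFisherGaussianity


end Summit.AtomisticToContinuum.BoseEinsteinCondensation.Theorems.BECConjugateDomination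

end
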